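import Summits.ResolutionOfSingularities.ResolutionOfSingularities.Theorems.FrobeniusClosingSteerVisitLawBricks
import Summits.ResolutionOfSingularities.ResolutionOfSingularities.Theorems.FrobeniusClosingSteerSwitchRecurrence
import Summits.ResolutionOfSingularities.ResolutionOfSingularities.Theorems.FrobeniusClosingSteerNoSingularCarrierStep
import Summits.ResolutionOfSingularities.ResolutionOfSingularities.Theorems.FrobeniusClosingSteerWords12MemberDatum

/-!
# Crux `Steer` (stmt-ResolutionOfSingularities-16345), chain W4.1, (Par-S) hARᵒ S1a — FILE 2b (telescope part): the COMPOSITE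
# STRICT-TRANSFORM LAW WITH UNIT COFACTOR between two visits of a steered run (res-L0-w41-plan-1 RULINGS 145 / 156c; res-type-096's repair
# R1 of `Words.VisitLawAt` clause 2 and hypothesis Hγ of R2; res-type-062 g15; Theses-free support)

OURS (campaign `res-hironaka`, rung L ★L-G4, slot W4.1; statements about the route's own objects — a σ_top-steered run `Words.IsSteeredRun O R P t p s`
and a VISIT PAIR `j < j′` (`Words.IsVisitPair`: consecutive point steps), under Hγ «every step strictly between is the strip along `(x)`»,
`x` an exceptional parameter of the point step `j`; they replace the role of no printed item and are NOT statements of the manuscript under review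
[claim: Hironaka2017, status: under-review]; AI review is weaker than expert review). Seat res-type-062 g15. Definition-free; no Theses file is imported.

## What is proved

res-type-096's CHECK (13:43:45Z) of tri-1's `VisitLawAt`: clause 2 needs a UNIT COFACTOR (the run's exceptional parameter at each step is
∃-quantified, so a given `x` is only `x_j` up to a unit), and «only x-strips between visits» is a hypothesis Hγ (to be discharged by the
termination fact S1c). This file proves the words-independent TELESCOPE behind clauses 1–2 in that repaired form:

* `excParam_eq_unit_mul` — two exceptional parameters of the SAME centre differ by a unit of the next member
  (`GeoDict.exists_mem_mul_of_isExcParamAlong` twice); `excParam_strip_eq_unit_mul` — along a principal centre `(x)` the step's parameter is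
  `x` times a unit (res-type-096's `VisitLaw.exists_isUnit_mul_eq_of_excParam_span_singleton`).
* `ring_const_of_strips` — strips keep the member: `R k = R (j+1)` for `j < k ≤ j′` (tree `NoSingularCarrier.eq_of_isLocalBlowupAlong_span_singleton`).
* **`visitLaw_telescope`** — under Hγ, with `e := j′ − j` steps: `R j′ = R (j+1)` and
  `∃ G W : K, G ∈ R j′ ∧ W ∈ R j′ ∧ W⁻¹ ∈ R j′ ∧ W ≠ 0 ∧ s j′ * x ^ e * W = s j − G`.
  The COUNT `e = ν/2` (ν the cleaned order at `j`) is the separate clord bookkeeping (α)(β)(δ) (res-type-096 p537842 / p535433, res-type-072);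
  with it this is exactly the repaired clause 2 consumed by `ArithReductionLegality.H3_of_pieces`.

[cite: NovacoskiSpivakovsky2014, Def. 2.11] [folklore]
-/

-- `Summit.<S>.<S>.…` duplicates the summit name by design (single-problem summit).
set_option linter.dupNamespace false

open IsLocalRing
open Literature.AlgebraicGeometry.Resolution (IsLocalBlowupAlong SubringDominates locAtCentre isUnit_subring_iff_inv_mem)

namespace Summit.ResolutionOfSingularities.ResolutionOfSingularities.Theorems.SwitchingDichotomy

namespace VisitLawTelescope

open Summit.ResolutionOfSingularities.ResolutionOfSingularities.Theorems.SwitchingDichotomy.SigmaTopLegality (IsPointStep)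
open Summit.ResolutionOfSingularities.ResolutionOfSingularities.Theorems.SwitchingDichotomy.Words (IsSteeredRun IsVisitPair)

variable {K : Type} [Field K] {O : ValuationSubring K}

/-! ## §1 Exceptional parameters of one centre agree up to a unit -/

/-- Two exceptional parameters `x, x'` of the same local blowing up `B ↦ B'` along `I` (elements of `I`, non-zero, of maximal `O`-value on `I`)
satisfy `x' = w·x` with `w, w⁻¹ ∈ B'`. [cite: NovacoskiSpivakovsky2014, Def. 2.11] [folklore] -/
theorem excParam_eq_unit_mul {B B' : Subring K} {I : Ideal B} (hbl : IsLocalBlowupAlong O B I B') {x x' : K}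
    (hx : (∃ h : x ∈ B, (⟨x, h⟩ : B) ∈ I) ∧ x ≠ 0 ∧ ∀ y : B, y ∈ I → O.valuation (y : K) ≤ O.valuation x)
    (hx' : (∃ h : x' ∈ B, (⟨x', h⟩ : B) ∈ I) ∧ x' ≠ 0 ∧ ∀ y : B, y ∈ I → O.valuation (y : K) ≤ O.valuation x') :
    ∃ w : K, w ∈ B' ∧ w⁻¹ ∈ B' ∧ x' = w * x := by
  obtain ⟨⟨hxB, hxI⟩, hx0, hxmax⟩ := hx
  obtain ⟨⟨hx'B, hx'I⟩, hx'0, hx'max⟩ := hx'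
  obtain ⟨w, hw, hw'⟩ := GeoDict.exists_mem_mul_of_isExcParamAlong hbl ⟨hxB, hxI⟩ hx0 hxmax ⟨x', hx'B⟩ hx'I
  obtain ⟨w', hw'mem, hw''⟩ := GeoDict.exists_mem_mul_of_isExcParamAlong hbl ⟨hx'B, hx'I⟩ hx'0 hx'max ⟨x, hxB⟩ hxI
  change x' = w * x at hw'
  change x = w' * x' at hw''
  refine ⟨w, hw, ?_, hw'⟩
  have hww' : w * w' = 1 := by
    have h : x' = (w * w') * x' := by
      calc x' = w * x := hw'
        _ = w * (w' * x') := by rw [← hw'']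
        _ = (w * w') * x' := by ring
    have := mul_right_cancel₀ hx'0 (h.symm.trans (one_mul x').symm)
    exact this
  have hw0 : w ≠ 0 := fun h => by rw [h, zero_mul] at hww'; exact zero_ne_one hww'
  have : w⁻¹ = w' := (eq_inv_of_mul_eq_one_right hww').symm
  rw [this]
  exact hw'mem

/-- Along a PRINCIPAL centre `(u)` of a member dominated by `O`, the step's exceptional parameter is `u` times a unit (res-type-096's
`VisitLaw.exists_isUnit_mul_eq_of_excParam_span_singleton`, restated with the inverse in the member). [folklore] -/
theorem excParam_strip_eq_unit_mul {B : Subring K} (hdom : SubringDominates B O.toSubring) (u : B) {x' : K}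
    (hx' : (∃ h : x' ∈ B, (⟨x', h⟩ : B) ∈ Ideal.span {u}) ∧ x' ≠ 0 ∧
      ∀ y : B, y ∈ Ideal.span {u} → O.valuation (y : K) ≤ O.valuation x') :
    ∃ r : K, r ∈ B ∧ r⁻¹ ∈ B ∧ r ≠ 0 ∧ x' = r * (u : K) := by
  obtain ⟨⟨hx'B, hx'P⟩, hx'0, hx'max⟩ := hx'
  obtain ⟨r, hr, hx'r⟩ := VisitLaw.exists_isUnit_mul_eq_of_excParam_span_singleton hdom u hx'B hx'P hx'0 hx'max
  obtain ⟨hr0, hrinv⟩ := (isUnit_subring_iff_inv_mem r).mp hr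
  exact ⟨r, r.2, hrinv, hr0, hx'r⟩

/-! ## §2 Strips keep the member -/

section Run

variable {R : ℕ → Subring K} {P : (i : ℕ) → Ideal (R i)} {t : K} {p : ℕ} {s : ℕ → K}

/-- **Ring constancy between visits.** Along a tower of local blowing ups, if every step `k` with `j < k < j′` is the strip along the principal
centre `(x)` (hypothesis Hγ), then `R k = R (j+1)` for `j < k ≤ j′`. [cite: NovacoskiSpivakovsky2014, Def. 2.11] [folklore] -/
theorem ring_const_of_strips (hbl : ∀ i, IsLocalBlowupAlong O (R i) (P i) (R (i + 1))) {j j' : ℕ} {x : K}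
    (Hγ : ∀ k, j < k → k < j' → ∃ hx : x ∈ R k, P k = Ideal.span {(⟨x, hx⟩ : R k)}) :
    ∀ k, j < k → k ≤ j' → R k = R (j + 1) := by
  intro k hjk hkj'
  induction k, (show j + 1 ≤ k from hjk) using Nat.le_induction with
  | base => rfl
  | succ n hn ih =>
    have hnj' : n < j' := Nat.lt_of_succ_le hkj'
    have hRn : R n = R (j + 1) := ih (Nat.lt_of_succ_le hn) hnj'.le
    obtain ⟨hx, hP⟩ := Hγ n (Nat.lt_of_succ_le hn) hnj'
    have hloc : locAtCentre (R n) O = R n := by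
      obtain ⟨m, rfl⟩ : ∃ m, n = m + 1 := ⟨n - 1, by omega⟩
      exact (hbl m).isLocalBlowup.locAtCentre_eq
    have hbl' : IsLocalBlowupAlong O (R n) (Ideal.span {(⟨x, hx⟩ : R n)}) (R (n + 1)) := hP ▸ hbl n
    rw [NoSingularCarrier.eq_of_isLocalBlowupAlong_span_singleton hloc _ hbl', hRn]

/-! ## §3 The telescope: composite strict-transform law with unit cofactor -/

/-- **Composite law between visits (telescope).** In a steered run (`R 0` dominated by `O`), let `j < j′` with Hγ «every step strictly between is
the strip along `(x)`», `x` an exceptional parameter of step `j` (unfolded `IsExcParamAlong`). Then `R j′ = R (j+1)` and the strict transforms obey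
`s j′ · x^(j′ − j) · W = s j − G` with `G ∈ R j′` and `W` a unit of `R j′` (`W, W⁻¹ ∈ R j′`, `W ≠ 0`). [folklore] -/
theorem visitLaw_telescope (hrun : IsSteeredRun O R P t p s) (hR0 : SubringDominates (R 0) O.toSubring)
    {j j' : ℕ} (hjj' : j < j') {x : K}
    (hx : (∃ h : x ∈ R j, (⟨x, h⟩ : R j) ∈ P j) ∧ x ≠ 0 ∧ ∀ y : R j, y ∈ P j → O.valuation (y : K) ≤ O.valuation x)
    (Hγ : ∀ k, j < k → k < j' → ∃ hx : x ∈ R k, P k = Ideal.span {(⟨x, hx⟩ : R k)}) :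
    R j' = R (j + 1) ∧ ∃ G W : K, G ∈ R j' ∧ W ∈ R j' ∧ W⁻¹ ∈ R j' ∧ W ≠ 0 ∧ s j' * x ^ (j' - j) * W = s j - G := by
  have hbl : ∀ i, IsLocalBlowupAlong O (R i) (P i) (R (i + 1)) := fun i => by
    obtain ⟨_, _, -, h, -⟩ := hrun.2 i
    exact h
  have hstep : ∀ i, ∃ x' g : K, ((∃ h : x' ∈ R i, (⟨x', h⟩ : R i) ∈ P i) ∧ x' ≠ 0 ∧
      ∀ y : R i, y ∈ P i → O.valuation (y : K) ≤ O.valuation x') ∧ g ∈ R i ∧ s i = x' * s (i + 1) + g := fun i => by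
    obtain ⟨_, _, -, -, h⟩ := hrun.2 i
    exact h
  have hdom : ∀ i, SubringDominates (R i) O.toSubring :=
    SigmaTopLegality.subringDominates_of_isLocalBlowup O R hR0 fun i => (hbl i).isLocalBlowup
  have hconst := ring_const_of_strips hbl Hγ
  -- the claim at every `k = j + 1 + n ≤ j'`, memberships in the constant member `R (j+1)`
  have key : ∀ n, j + 1 + n ≤ j' → ∃ G W : K, G ∈ R (j + 1) ∧ W ∈ R (j + 1) ∧ W⁻¹ ∈ R (j + 1) ∧ W ≠ 0 ∧
      s (j + 1 + n) * x ^ (n + 1) * W = s j - G := by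
    intro n
    induction n with
    | zero =>
      intro _
      obtain ⟨x', g, hx', hg, hsj⟩ := hstep j
      obtain ⟨w, hw, hwinv, hx'w⟩ := excParam_eq_unit_mul (hbl j) hx hx'
      have hw0 : w ≠ 0 := fun h => hx'.2.1 (by rw [hx'w, h, zero_mul])
      refine ⟨g, w, (hbl j).isLocalBlowup.le hg, hw, hwinv, hw0, ?_⟩
      rw [Nat.add_zero, hsj, hx'w]; ring
    | succ n ih =>
      intro hn
      have hk : j + 1 + n < j' := by omega
      obtain ⟨G, W, hG, hW, hWinv, hW0, hlaw⟩ := ih hk.le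
      set k := j + 1 + n with hkdef
      obtain ⟨hxk, hPk⟩ := Hγ k (by omega) hk
      obtain ⟨x', g, hx', hg, hsk⟩ := hstep k
      have hRk : R k = R (j + 1) := hconst k (by omega) hk.le
      have hRk1 : R (k + 1) = R (j + 1) := hconst (k + 1) (by omega) (by omega)
      -- the strip's parameter is `x` times a unit of `R k`
      have hx'' : (∃ h : x' ∈ R k, (⟨x', h⟩ : R k) ∈ Ideal.span {(⟨x, hxk⟩ : R k)}) ∧ x' ≠ 0 ∧
          ∀ y : R k, y ∈ Ideal.span {(⟨x, hxk⟩ : R k)} → O.valuation (y : K) ≤ O.valuation x' := by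
        obtain ⟨⟨h1, h2⟩, h3, h4⟩ := hx'
        exact ⟨⟨h1, hPk ▸ h2⟩, h3, fun y hy => h4 y (hPk ▸ hy)⟩
      obtain ⟨r, hr, hrinv, hr0, hx'r⟩ := excParam_strip_eq_unit_mul (hdom k) ⟨x, hxk⟩ hx''
      refine ⟨G + g * x ^ (n + 1) * W, r * W, ?_, ?_, ?_, mul_ne_zero hr0 hW0, ?_⟩
      · refine (R (j + 1)).add_mem hG ((R (j + 1)).mul_mem ((R (j + 1)).mul_mem (hRk ▸ hg)
          ((R (j + 1)).pow_mem (hRk ▸ hxk) _)) hW)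
      · exact (R (j + 1)).mul_mem (hRk ▸ hr) hW
      · rw [mul_inv]
        exact (R (j + 1)).mul_mem (hRk ▸ hrinv) hWinv
      · have e : j + 1 + (n + 1) = k + 1 := by omega
        rw [e]
        have h1 : s k = x' * s (k + 1) + g := hsk
        calc s (k + 1) * x ^ (n + 1 + 1) * (r * W) = (x' * s (k + 1)) * x ^ (n + 1) * W := by rw [hx'r]; ring
          _ = (s k - g) * x ^ (n + 1) * W := by rw [h1]; ring
          _ = s k * x ^ (n + 1) * W - g * x ^ (n + 1) * W := by ring
          _ = s j - G - g * x ^ (n + 1) * W := by rw [hlaw]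
          _ = s j - (G + g * x ^ (n + 1) * W) := by ring
  have hRj' : R j' = R (j + 1) := hconst j' hjj' le_rfl
  obtain ⟨G, W, hG, hW, hWinv, hW0, hlaw⟩ := key (j' - (j + 1)) (by omega)
  have e1 : j + 1 + (j' - (j + 1)) = j' := by omega
  have e2 : j' - (j + 1) + 1 = j' - j := by omega
  rw [e1, e2] at hlaw
  exact ⟨hRj', G, W, hRj' ▸ hG, hRj' ▸ hW, hRj' ▸ hWinv, hW0, hlaw⟩

/-- **The telescope at a visit pair** (`Words.IsVisitPair R P j j′`), the shape the ARITH-REDUCTION's legality slot reads with `e := j′ − j`;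
the count `j′ − j = ν/2` is the clord bookkeeping (α)(β)(δ). [folklore] -/
theorem visitLaw_telescope_of_isVisitPair (hrun : IsSteeredRun O R P t p s) (hR0 : SubringDominates (R 0) O.toSubring)
    {j j' : ℕ} (hvisit : IsVisitPair R P j j') {x : K}
    (hx : (∃ h : x ∈ R j, (⟨x, h⟩ : R j) ∈ P j) ∧ x ≠ 0 ∧ ∀ y : R j, y ∈ P j → O.valuation (y : K) ≤ O.valuation x)
    (Hγ : ∀ k, j < k → k < j' → ∃ hx : x ∈ R k, P k = Ideal.span {(⟨x, hx⟩ : R k)}) :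
    R j' = R (j + 1) ∧ ∃ G W : K, G ∈ R j' ∧ W ∈ R j' ∧ W⁻¹ ∈ R j' ∧ W ≠ 0 ∧ s j' * x ^ (j' - j) * W = s j - G :=
  visitLaw_telescope hrun hR0 hvisit.1 hx Hγ

end Run

end VisitLawTelescope

end Summit.ResolutionOfSingularities.ResolutionOfSingularities.Theorems.SwitchingDichotomy
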